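import Mathlib
import Literature.NumberTheory.Sieve.Maynard2016ScaledFunctionals
import HarnessLib

/-!
# Maynard 2016, Lemma 8: the residual analytic input in its weakest form (bounded `F`)

Topic `Literature/NumberTheory/Sieve`. J. Maynard, *Large gaps between primes*, Ann. of Math. (2)
183 (2016), 915–933 = arXiv:1408.5110, §8, proof of Lemma 8 (the approximation step).

The chain `ScaledDensity → BumpDensity → Lemma8Density → Lemma8F → Lemma8` (files
`Maynard2016ScaledFunctionals`, `…BumpData`, `…Lemma8FReduction`, `…Lemma8Reduction`) asks the
approximation for EVERY non-negative admissible (`L²`) `F`. Only the explicit large-`k` witness of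
Maynard 2015 is ever approximated, and that witness is BOUNDED BY `1`
(`F = 1_{R_k} ∏_i g(t_i)`, `0 ≤ g ≤ 1`): `exists_bdd_maynardFunctional_gt` (the tree's
`exists_maynardFunctional_gt_holds`, re-proved with `0 ≤ F ≤ 1` exported). Hence the weakest
sufficient form of the residual input:

* `ScaledDensityBdd` — for `k ≥ 1`, a measurable `F` with `0 ≤ F ≤ 1` supported in `R_k`, and
  `ε > 0`, there are `J`, `c_j > 0` and bump data `(w, φ)` (`IsBumpData`) such that the two
  functionals of `Σ_j c_j ∏_ℓ φ_{ℓ,j}(t_ℓ)` are within `ε` of those of `t ↦ F(10t)`.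
  Not proved here. A proof route needing NO `L²` theory: approximate `G = F(10·)` FROM BELOW,
  `0 ≤ P ≤ G`, in `L¹` (grid cells inside the support, coefficient `inf_Q G`… — or, for the
  functionals only, any `P ≤ G` with `∫ (G − P)` small), since for `0 ≤ P ≤ G ≤ 1`:
  `0 ≤ ∫ G² − ∫ P² ≤ 2 ∫ (G − P)` and `0 ≤ J_i(G) − J_i(P) ≤ (1/5) ∫ (G − P)`;

and `lemma8F_of_scaledDensityBdd : ScaledDensityBdd → Lemma8F` (PROVED: the bump data are turned into
sieve data by `primData`, the functionals are identified by `I1_primData`/`J1_primData` and the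
substitution lemmas `integral_sq_smul_ten`/`integral_J_smul_ten`, and the ratio is transferred as in
`lemma8F_of_density`), whence `theorem1_of_lemma7_scaledDensityBdd : Lemma7 → ScaledDensityBdd →
Maynard2016_theorem1`.

## References

* J. Maynard, *Large gaps between primes*, Ann. of Math. (2) 183 (2016), 915–933; arXiv:1408.5110,
  Lemma 8 (proof). [Maynard2016LargeGaps]
* J. Maynard, *Small gaps between primes*, Ann. of Math. (2) 181 (2015), 383–413, Prop. 4.3 (3), §7.
  [Maynard2015]
-/

open Filter Finset MeasureTheory Set
open scoped Topology ContDiff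

namespace Literature.NumberTheory.Sieve

namespace Maynard2016

open MaynardLargeK

/-! ### The large-`k` witness is bounded by `1` -/

/-- **Maynard 2015, Prop. 4.3 (3), bounded non-negative witness**: for `k ≥ 2^35` there is an
admissible `F` on `R_k` with `0 ≤ F ≤ 1` and `(Σ_m J_k^{(m)}(F))/I_k(F) > log k − 2 log log k − 2`
(the witness `1_{R_k} ∏_i g(t_i)`, `g = 1_{[0,τ]}(1 + Bu)⁻¹ ∈ [0,1]`, of the tree's
`exists_maynardFunctional_gt_holds`). [cite: Maynard2015, Prop. 4.3 (3), §7] -/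
theorem exists_bdd_maynardFunctional_gt :
    ∃ k₀ : ℕ, ∀ k ≥ k₀, ∃ F : (Fin k → ℝ) → ℝ, IsMaynardAdmissible k F ∧
      (∀ t, 0 ≤ F t ∧ F t ≤ 1) ∧
      Real.log k - 2 * Real.log (Real.log k) - 2 < maynardFunctional k F := by
  refine ⟨2 ^ 35, fun k hk => ?_⟩
  obtain ⟨n, rfl⟩ : ∃ n, k = n + 1 := ⟨k - 1, by omega⟩
  obtain ⟨kR, hkR⟩ : ∃ kR : ℝ, kR = (n : ℝ) + 1 := ⟨_, rfl⟩
  have hk35 : (2 : ℝ) ^ 35 ≤ kR := by rw [hkR]; exact_mod_cast hk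
  have hkpos : 0 < kR := by rw [hkR]; positivity
  obtain ⟨ℓ, hℓ⟩ : ∃ ℓ : ℝ, ℓ = Real.log kR := ⟨_, rfl⟩
  have hℓ24 : 24 ≤ ℓ := by
    have h1 : Real.log ((2 : ℝ) ^ 35) ≤ ℓ := by rw [hℓ]; exact Real.log_le_log (by positivity) hk35
    rw [Real.log_pow] at h1
    have h2 := Real.log_two_gt_d9
    push_cast at h1
    linarith
  have hℓpos : 0 < ℓ := by linarith
  obtain ⟨A, hA⟩ : ∃ A : ℝ, A = ℓ - 2 * Real.log ℓ := ⟨_, rfl⟩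
  have hA16 : 16 ≤ A := hA ▸ sixteen_le_sub_two_mul_log hℓ24
  have hApos : 0 < A := by linarith
  obtain ⟨e, he⟩ : ∃ e : ℝ, e = Real.exp A := ⟨_, rfl⟩
  have hepos : 0 < e := by rw [he]; exact Real.exp_pos A
  have hke : kR = e * ℓ ^ 2 := by
    have h1 : Real.exp ℓ = kR := by rw [hℓ, Real.exp_log hkpos]
    have h2 : Real.exp (2 * Real.log ℓ) = ℓ ^ 2 := by
      rw [two_mul, Real.exp_add, Real.exp_log hℓpos, sq]
    rw [he, hA, Real.exp_sub, h1, h2]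
    field_simp
  obtain ⟨B, hB⟩ : ∃ B : ℝ, B = A * kR := ⟨_, rfl⟩
  have hBpos : 0 < B := by rw [hB]; positivity
  obtain ⟨τ, hτ⟩ : ∃ τ : ℝ, τ = (e - 1) / (A * kR) := ⟨_, rfl⟩
  have hτ0 : 0 ≤ τ := by
    rw [hτ]
    have he1 : 1 ≤ e := by rw [he]; linarith [Real.add_one_le_exp A]
    exact div_nonneg (by linarith) (by positivity)
  have hBτ : 1 + B * τ = e := by
    rw [hB, hτ]; field_simp; ring
  obtain ⟨g, hg⟩ : ∃ g : ℝ → ℝ, g = fun x => (Icc 0 τ).indicator (fun x => (1 + B * x)⁻¹) x :=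
    ⟨_, rfl⟩
  have hgm : Measurable g := by rw [hg]; exact measurable_indicator_inv
  have hg0 : ∀ x, 0 ≤ g x := fun x => by rw [hg]; exact indicator_inv_nonneg hBpos.le x
  have hg1 : ∀ x, g x ≤ 1 := fun x => by rw [hg]; exact indicator_inv_le_one hBpos.le x
  have hgsupp : ∀ x, g x ≠ 0 → x ∈ Icc 0 τ := fun x hx =>
    Set.mem_of_indicator_ne_zero (by rwa [hg] at hx)
  have hg₀ : 0 < (1 + B * τ)⁻¹ := by rw [hBτ]; positivity
  have hgmin : ∀ x ∈ Icc 0 τ, (1 + B * τ)⁻¹ ≤ g x := fun x hx => by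
    rw [hg]; exact inv_le_indicator_inv hBpos.le hx
  have hL : ∫ x, g x = A / (A * kR) := by
    have : ∫ x, g x = Real.log (1 + B * τ) / B := by rw [hg]; exact integral_indicator_inv hBpos hτ0
    rw [this, hBτ, he, Real.log_exp, hB]
  have hW : ∫ x, g x ^ 2 = (1 - e⁻¹) / (A * kR) := by
    have : ∫ x, g x ^ 2 = (1 - (1 + B * τ)⁻¹) / B := by
      rw [hg]; exact integral_indicator_inv_sq hBpos hτ0
    rw [this, hBτ, hB]
  have hM1 : ∫ x, x * g x ^ 2 = (A - 1 + e⁻¹) / (A * kR) ^ 2 := by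
    have : ∫ x, x * g x ^ 2 = (Real.log (1 + B * τ) - 1 + (1 + B * τ)⁻¹) / B ^ 2 := by
      rw [hg]; exact integral_mul_indicator_inv_sq hBpos hτ0
    rw [this, hBτ, he, Real.log_exp, hB, ← he]
  set ν := (∫ x, x * g x ^ 2) / ∫ x, g x ^ 2 with hν
  have hν' : ν = ((A - 1 + e⁻¹) / (A * kR) ^ 2) / ((1 - e⁻¹) / (A * kR)) := by
    rw [hν, hW, hM1]
  obtain ⟨hτpos, hτ1, hD, hX, hfinal⟩ :=
    largeK_numeric_bound hℓ24 hA he hke hkR hτ hν'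
  have hratio := le_maynardFunctional_indicator_prod (n := n) hgm hg0 hg1 hgsupp hg₀ hgmin hτpos
    hτ1 rfl rfl hD hX
  rw [← hν, hL, hW] at hratio
  refine ⟨(maynardSimplex (n + 1)).indicator fun t => ∏ i, g (t i),
    isMaynardAdmissible_indicator_prod hgm hg0 hg1 hg₀ hgmin hτpos hτ1 rfl rfl,
    fun t => ⟨Set.indicator_nonneg (fun s _ => Finset.prod_nonneg fun i _ => hg0 (s i)) t,
      (Set.indicator_le_self' (fun x _ => Finset.prod_nonneg fun i _ => hg0 (x i)) t).trans
        (Finset.prod_le_one (fun i _ => hg0 (t i)) fun i _ => hg1 (t i))⟩, ?_⟩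
  have hcast : (((n + 1 : ℕ) : ℝ)) = kR := by rw [hkR]; push_cast; ring
  rw [hcast, ← hℓ]
  exact lt_of_lt_of_le hfinal hratio


/-! ### The residual input, bounded form -/

/-- **Maynard 2016, Lemma 8, approximation step — bounded form** (the weakest form used): for
`k ≥ 1`, a measurable `F : ℝ^k → [0, 1]` supported in the unit simplex `R_k`, and `ε > 0`, there are
`J`, `c_j > 0` and bump data `(w_{ℓ,j}, φ_{ℓ,j})` (`IsBumpData`: smooth, `≥ 0`, `φ_{ℓ,j} = 0` on
`[w_{ℓ,j}, ∞)`, positive somewhere on `[0,∞)`, `Σ_ℓ w_{ℓ,j} ≤ 1/10`) such that, with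
`P(t) = Σ_j c_j ∏_ℓ φ_{ℓ,j}(t_ℓ)` and `G(t) = F(10t)`,
`|∫_{t ≥ 0} P² − ∫_{t ≥ 0} G²| ≤ ε` and, for every `i`,
`|∫ (∫_{u>0} P(t; t_i:=u) du)² dt − ∫ (∫_{u>0} G(t; t_i:=u) du)² dt| ≤ ε` (outer integrals over
`{t_i ∈ [0,1], t_ℓ ≥ 0 (ℓ ≠ i)}`) ("`F` is a smooth approximation to `F_k(10t_1,…,10t_k)`").
Named fact, not proved here. [cite: Maynard2016LargeGaps, Lemma 8 (proof, approximation step)] -/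
def ScaledDensityBdd : Prop :=
  ∀ k : ℕ, 1 ≤ k → ∀ F : (Fin k → ℝ) → ℝ, Measurable F → Function.support F ⊆ maynardSimplex k →
    (∀ t, 0 ≤ F t ∧ F t ≤ 1) → ∀ ε : ℝ, 0 < ε →
      ∃ (J : ℕ) (c : Fin J → ℝ) (w : Fin k → Fin J → ℝ) (φ : Fin k → Fin J → ℝ → ℝ),
        (∀ j, 0 < c j) ∧ IsBumpData k J w φ ∧
          |(∫ t in Set.univ.pi (fun _ : Fin k => Set.Ici (0 : ℝ)), bumpSum c φ t ^ 2) -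
              ∫ t in Set.univ.pi (fun _ : Fin k => Set.Ici (0 : ℝ)), F ((10 : ℝ) • t) ^ 2| ≤ ε ∧
            ∀ i, |(∫ t in Set.univ.pi (fun ℓ : Fin k => if ℓ = i then Set.Icc (0 : ℝ) 1
                  else Set.Ici 0),
                (∫ u in Set.Ioi (0 : ℝ), bumpSum c φ (Function.update t i u)) ^ 2) -
              ∫ t in Set.univ.pi (fun ℓ : Fin k => if ℓ = i then Set.Icc (0 : ℝ) 1
                  else Set.Ici 0),
                (∫ u in Set.Ioi (0 : ℝ), F ((10 : ℝ) • Function.update t i u)) ^ 2| ≤ ε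

/-! ### `Lemma8F` from the bounded form -/

/-- Transfer of a ratio bound through an `ε`-approximation of the functionals. [folklore] -/
private theorem ratio_transfer {c ℓ I S k ε I₁ S₁ : ℝ} (hc : 0 < c) (hℓ : 0 < ℓ) (hI : 0 < I)
    (hSI : c * ℓ * I ≤ S) (hε1 : ε ≤ I / 2) (hε2 : k * ε ≤ c * ℓ * I / 2)
    (hI₁lo : I - ε ≤ I₁) (hI₁hi : I₁ ≤ I + ε) (hS₁ : S - k * ε ≤ S₁) :
    0 < I₁ ∧ c / 4 * ℓ * I₁ ≤ S₁ := by
  refine ⟨by linarith, ?_⟩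
  have h1 : c / 4 * ℓ * I₁ ≤ c / 4 * ℓ * (3 / 2 * I) :=
    mul_le_mul_of_nonneg_left (by linarith) (by positivity)
  nlinarith [mul_pos hc hℓ]

/-- `log k − 2 log log k − 2 ≥ (log k)/2` once `log k ≥ 64`. [folklore] -/
private theorem half_le_sub_log {ℓ : ℝ} (hℓ : 64 ≤ ℓ) : ℓ / 2 ≤ ℓ - 2 * Real.log ℓ - 2 := by
  have hℓ0 : 0 < ℓ := by linarith
  have h1 := Real.log_le_sub_one_of_pos (Real.sqrt_pos.2 hℓ0)
  have h2 : Real.log (Real.sqrt ℓ) = Real.log ℓ / 2 := Real.log_sqrt hℓ0.le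
  have h3 : Real.sqrt ℓ ^ 2 = ℓ := Real.sq_sqrt hℓ0.le
  have h4 : 8 ≤ Real.sqrt ℓ := by
    rw [show (8 : ℝ) = Real.sqrt (8 ^ 2) by rw [Real.sqrt_sq (by norm_num)]]
    exact Real.sqrt_le_sqrt (by norm_num; linarith)
  nlinarith

/-- **The `F`-part of Lemma 8 from the bounded scaled-density fact, PROVED.**
[cite: Maynard2016LargeGaps, Lemma 8] -/
theorem lemma8F_of_scaledDensityBdd (hD : ScaledDensityBdd) : Lemma8F := by
  obtain ⟨k₀, hk₀⟩ := exists_bdd_maynardFunctional_gt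
  refine ⟨1 / 20 / 4, by norm_num, max k₀ ⌈Real.exp 64⌉₊, fun k hk => ?_⟩
  obtain ⟨F, hF, hF01, hgt⟩ := hk₀ k ((le_max_left _ _).trans hk)
  have hk64 : Real.exp 64 ≤ k :=
    (Nat.le_ceil _).trans (by exact_mod_cast (le_max_right _ _).trans hk)
  have hℓ : 64 ≤ Real.log k := by
    have := Real.log_le_log (Real.exp_pos _) hk64; rwa [Real.log_exp] at this
  have hk1R : (1 : ℝ) ≤ k := by linarith [Real.add_one_le_exp (64 : ℝ)]
  have hk1 : 1 ≤ k := by exact_mod_cast hk1R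
  have hkpos : (0 : ℝ) < k := by linarith
  have hℓpos : 0 < Real.log k := by linarith
  -- the model ratio: `Σ_i J_k^{(i)} ≥ (log k)/2 · I_k`
  have hIpos := hF.maynardI_pos
  have hfun : Real.log k / 2 < (∑ i, maynardJ k i F) / maynardI k F :=
    lt_of_le_of_lt (half_le_sub_log hℓ) hgt
  have hJsum : Real.log k / 2 * maynardI k F ≤ ∑ i, maynardJ k i F :=
    ((lt_div_iff₀ hIpos).1 hfun).le
  have hSI : 1 / 20 * Real.log k * (maynardI k F / 10 ^ k) ≤
      (∑ i, maynardJ k i F) / 10 ^ (k + 1) := by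
    have h1 : 1 / 20 * Real.log k * (maynardI k F / 10 ^ k) =
        (Real.log k / 2 * maynardI k F) / (10 ^ k * 10) := by ring
    rw [h1, pow_succ]
    exact div_le_div_of_nonneg_right hJsum (by positivity)
  have hI : 0 < maynardI k F / 10 ^ k := by positivity
  -- the approximation
  set ε : ℝ := min (maynardI k F / 10 ^ k / 2)
    (1 / 20 * Real.log k * (maynardI k F / 10 ^ k) / 2 / k) with hε
  have hεpos : 0 < ε := lt_min (by positivity) (by positivity)
  -- bump data from the scaled-density fact, turned into sieve data by primitives
  obtain ⟨J, cj, w, φ, hc, hφ, hIb, hJb⟩ :=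
    hD k hk1 F hF.measurable hF.support_subset hF01 ε hεpos
  have hcont : ∀ ℓ j, Continuous (φ ℓ j) := fun ℓ j => (hφ.smooth ℓ j).continuous
  have hdat : IsSieveDataF k J cj (primData w φ) := isSieveDataF_primData hc hφ
  have hI1 : |I1 cj (primData w φ) - maynardI k F / 10 ^ k| ≤ ε := by
    rw [I1_primData cj hcont, ← integral_sq_smul_ten F hF.support_subset]
    exact hIb
  have hJ1 : ∀ i, |J1 cj (primData w φ) i - maynardJ k i F / 10 ^ (k + 1)| ≤ ε := by
    intro i
    rw [J1_primData cj hcont, ← integral_J_smul_ten hk1 F hF.support_subset i]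
    exact hJb i
  set Fd := primData w φ with hFd
  have hε1 : ε ≤ maynardI k F / 10 ^ k / 2 := min_le_left _ _
  have hε2 : (k : ℝ) * ε ≤ 1 / 20 * Real.log k * (maynardI k F / 10 ^ k) / 2 := by
    have h1 := mul_le_mul_of_nonneg_left (min_le_right (maynardI k F / 10 ^ k / 2)
      (1 / 20 * Real.log k * (maynardI k F / 10 ^ k) / 2 / k)) hkpos.le
    have h2 : (k : ℝ) * (1 / 20 * Real.log k * (maynardI k F / 10 ^ k) / 2 / k) =
        1 / 20 * Real.log k * (maynardI k F / 10 ^ k) / 2 := by field_simp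
    rw [← hε] at h1
    linarith
  have hsum : (∑ i, maynardJ k i F) / 10 ^ (k + 1) - k * ε ≤ ∑ i, J1 cj Fd i := by
    have h1 : ∀ i ∈ (Finset.univ : Finset (Fin k)),
        maynardJ k i F / 10 ^ (k + 1) - ε ≤ J1 cj Fd i := by
      intro i _
      have := (abs_le.1 (hJ1 i)).1
      linarith
    have h2 := Finset.sum_le_sum h1
    simp only [Finset.sum_sub_distrib, Finset.sum_const, Finset.card_univ, Fintype.card_fin,
      nsmul_eq_mul] at h2
    rw [Finset.sum_div]
    linarith
  have hI₁lo : maynardI k F / 10 ^ k - ε ≤ I1 cj Fd := by linarith [(abs_le.1 hI1).1]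
  have hI₁hi : I1 cj Fd ≤ maynardI k F / 10 ^ k + ε := by linarith [(abs_le.1 hI1).2]
  obtain ⟨hpos, hmain⟩ := ratio_transfer (by norm_num : (0 : ℝ) < 1 / 20) hℓpos hI hSI
    hε1 hε2 hI₁lo hI₁hi hsum
  exact ⟨J, cj, Fd, hdat, hpos, hmain⟩


/-- `Lemma8` from the bounded form. [cite: Maynard2016LargeGaps, Lemma 8] -/
theorem lemma8_of_scaledDensityBdd (hD : ScaledDensityBdd) : Lemma8 :=
  lemma8_of_lemma8F (lemma8F_of_scaledDensityBdd hD)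

/-- `GPYMeasures` from `Lemma7` and the bounded form. [cite: Maynard2016LargeGaps, §8 (deduction of Proposition 5)] -/
theorem gpyMeasures_of_lemma7_scaledDensityBdd (h7 : Lemma7) (hD : ScaledDensityBdd) : GPYMeasures :=
  gpyMeasures_of_lemma7_lemma8 h7 (lemma8_of_scaledDensityBdd hD)

/-- **Maynard's Theorem 1 from `Lemma7` and `ScaledDensityBdd`.** [cite: Maynard2016LargeGaps, Theorem 1] -/
theorem theorem1_of_lemma7_scaledDensityBdd (h7 : Lemma7) (hD : ScaledDensityBdd) :
    Literature.NumberTheory.Sieve.Maynard2016_theorem1 :=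
  theorem1_of_lemma7_lemma8 h7 (lemma8_of_scaledDensityBdd hD)

/-- **`∀ c, RankinConstant c` from `Lemma7` and `ScaledDensityBdd`.** [cite: Maynard2016LargeGaps, Theorem 1] -/
theorem forall_rankinConstant_of_lemma7_scaledDensityBdd (h7 : Lemma7) (hD : ScaledDensityBdd)
    (c : ℝ) : Literature.NumberTheory.Sieve.RankinConstant c :=
  forall_rankinConstant_of_lemma7_lemma8 h7 (lemma8_of_scaledDensityBdd hD) c

/-- The general (all non-negative admissible `F`) scaled form implies `Lemma8F` through either chain;
recorded for cross-reference. [cite: Maynard2016LargeGaps, Lemma 8] -/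
theorem lemma8F_of_scaledDensity (hS : ScaledDensity) : Lemma8F :=
  lemma8F_of_bumpDensity (bumpDensity_of_scaledDensity hS)

end Maynard2016

end Literature.NumberTheory.Sieve
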